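/-
Copyright (c) 2026. All rights reserved.
Released under Apache 2.0 license as described in the file LICENSE.
Authors: abc-iut cell, seat abc-iut-L4-t15 (gen 6).
-/
import Mathlib.Topology.Algebra.ClopenNhdofOne
import Mathlib.Topology.Algebra.OpenSubgroup
import Mathlib.Algebra.Group.Subgroup.Pointwise
import Mathlib.Tactic.Ring

/-!
# Transport of the "coprime power lands in `P` modulo open normal subgroups" hypothesis

In the `p`-by-metacyclic profinite setting (`Literature/GroupTheory/ProfiniteCommutatorWidthPByMetacyclic`)
hypothesis `(S1)` reads: for every open normal `W ⊴ G` some `e` prime to `p` has `t ^ e ∈ P ⊔ W`.  We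
show it passes to an open subgroup `U ⊇ P` with `t_U = t ^ m ∈ U`
(`exists_coprime_pow_mem_subgroupOf_sup`): every open normal subgroup of `↥U` contains the trace of an
open normal subgroup of the profinite group `G`.

Mathlib-only; no definitions, no instances (cell abc-iut, GAP-LEDGER G-L3d2g2-1: inheritance step of the
strong-completeness reduction for `p`-by-metacyclic profinite groups). [cite: RibesZalesskii2010, §2.1]
-/

namespace Literature.GroupTheory

open scoped Pointwise

variable {G : Type*} [Group G] [TopologicalSpace G] [IsTopologicalGroup G] [CompactSpace G]
  [TotallyDisconnectedSpace G]

/-- **Open normal subgroups of an open subgroup contain traces of open normal subgroups.**  For `U ≤ G`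
open in a profinite group and `W ⊴ ↥U` open normal, some open normal `W' ⊴ G` satisfies: every
`w ∈ W'` is `↑w₀` for some `w₀ ∈ W`. [cite: RibesZalesskii2010, §2.1] -/
theorem exists_openNormalSubgroup_subset_image (U : Subgroup G) (hUo : IsOpen (U : Set G))
    (W : OpenNormalSubgroup U) :
    ∃ W' : OpenNormalSubgroup G, ((W' : Subgroup G) : Set G) ⊆ Subtype.val '' ((W : Subgroup U) : Set U) := by
  have hSo : IsOpen (Subtype.val '' ((W : Subgroup U) : Set U) : Set G) :=
    hUo.isOpenMap_subtype_val _ W.isOpen'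
  have h1 : (1 : G) ∈ (Subtype.val '' ((W : Subgroup U) : Set U) : Set G) :=
    ⟨1, (W : Subgroup U).one_mem, rfl⟩
  exact ProfiniteGrp.exist_openNormalSubgroup_sub_open_nhds_of_one hSo h1

/-- **`(S1)` passes to `↥U`.**  Let `P ≤ U ≤ G` with `U` open in the profinite group `G`, `t ∈ G` and
`t ^ m ∈ U`.  If for every open normal `W ⊴ G` some `e` prime to `p` has `t ^ e ∈ P ⊔ W`, then for every
open normal `W ⊴ ↥U` some `e` prime to `p` has `(t ^ m) ^ e ∈ P_U ⊔ W` (`P_U = P.subgroupOf U`).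
[cite: RibesZalesskii2010, §2.1] -/
theorem exists_coprime_pow_mem_subgroupOf_sup (U P : Subgroup G) (hUo : IsOpen (U : Set G))
    (hPU : P ≤ U) (t : G) {p m : ℕ} (htm : t ^ m ∈ U)
    (hte : ∀ W : OpenNormalSubgroup G, ∃ e : ℕ, p.Coprime e ∧ t ^ e ∈ (P ⊔ (W : Subgroup G))) :
    ∀ W : OpenNormalSubgroup U, ∃ e : ℕ, p.Coprime e ∧
      (⟨t ^ m, htm⟩ : U) ^ e ∈ (P.subgroupOf U ⊔ (W : Subgroup U)) := by
  intro W
  obtain ⟨W', hW'⟩ := exists_openNormalSubgroup_subset_image U hUo W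
  obtain ⟨e, hpe, hteW⟩ := hte W'
  refine ⟨e, hpe, ?_⟩
  -- `(t ^ e) ^ m = q * w` with `q ∈ P`, `w ∈ W'`
  have h1 : (t ^ e) ^ m ∈ ((P ⊔ (W' : Subgroup G) : Subgroup G) : Set G) :=
    Subgroup.pow_mem _ hteW m
  rw [Subgroup.mul_normal] at h1
  obtain ⟨q, hq, w, hw, hqw⟩ := Set.mem_mul.mp h1
  obtain ⟨w₀, hw₀, hw₀w⟩ := hW' hw
  have hqU : q ∈ U := hPU hq
  have key : (⟨t ^ m, htm⟩ : U) ^ e = ⟨q, hqU⟩ * w₀ := by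
    apply Subtype.ext
    simp only [SubgroupClass.coe_pow, Subgroup.coe_mul, hw₀w, hqw]
    rw [← pow_mul, ← pow_mul, mul_comm]
  rw [key]
  exact Subgroup.mul_mem _ (Subgroup.mem_sup_left (Subgroup.mem_subgroupOf.mpr hq))
    (Subgroup.mem_sup_right hw₀)

end Literature.GroupTheory
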